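import Mathlib.Algebra.Lie.Subalgebra
import Literature.AlgebraicGeometry.Hyperkaehler.LooijengaLuntsVerbitsky
import Literature.AlgebraicGeometry.Hyperkaehler.GeneralizedKummerType
import Literature.AlgebraicGeometry.Motives.ComplexPointsManifold
import Literature.AlgebraicTopology.SingularHomology.CohomologyFiniteness
import Literature.Algebra.Lie.Sl2PartnerUnique
import HarnessLib

/-!
# The structure of the LLV algebra of a `Kumⁿ`-type manifold: `g ≅ so(H² ⊕ U)` — NAMED FACT, and the
# Lie-generation consequence `g = Lie⟨L_{H²}, Λ_ℓ⟩`

Layer `Literature/AlgebraicGeometry/Hyperkaehler`.  CITE record (statements-first) for cell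
`hodge-kum4` (ladder HodgeAV rung H3): the Looijenga–Lunts–Verbitsky structure theorem for the LLV
algebra `g = g_tot(X)` of a compact hyper-Kähler manifold, in the OPERATOR form printed in
Green–Kim–Laza–Robles' proof of their Theorem 14, recorded for projective manifolds of `Kumⁿ`-type
(the tree's `IsOfGeneralizedKummerType n X`; Beauville: `Kⁿ(A)` and its deformations are compact
hyper-Kähler), together with its elementary consequence used by the Lie-generation lemma of the
`Kum⁴` Hodge-conjecture blueprint: for every class `ℓ` with the Lefschetz property, the Lefschetz
operators `L_x` (`x ∈ H²`) and the single dual Lefschetz operator `Λ_ℓ` already generate `g`.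

## Sources (read: arXiv texts `paper:arxiv-1906.03432` pp. 8–9, `paper:arxiv-alg-geom-9604014` §1, §4)

* E. Looijenga, V. Lunts, *A Lie algebra attached to a projective variety*, Invent. Math. 129
  (1997), (4.5) Proposition: "(i) The pair `(g_tot(X; ℝ), h)` is of Jordan–Lefschetz type […] with
  `g_tot(X; ℝ)` isomorphic to `so(4, b₂(X) - 2)`. (ii) We have natural identifications
  `g_tot(X; ℝ)₂ ≅ H²(X; ℝ)` and `g_tot(X; ℝ)₀ ≅ so(q₀) × ℝh`."; (4.7) Example: for Beauville's
  generalized Kummer varieties "`g_tot(K_m; ℝ) ≅ so(4, 5)`"; §1 p. 4: "This `f` is then unique";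
  "[`f`] defines a rational map `f : 𝔞 → gl(M)` in the sense of algebraic geometry" (so the
  formation of `g` commutes with extension of scalars `ℚ ⊂ ℝ ⊂ ℂ`).
* M. Green, Y.-J. Kim, R. Laza, C. Robles, *The LLV decomposition of hyper-Kähler cohomology*,
  Math. Ann. 382 (2022) (arXiv:1906.03432), Theorem 14 (Looijenga–Lunts, Verbitsky): "Let `X` be a
  compact hyper-Kähler manifold. Then […] `ḡ ≅ so(V̄, q̄)`, `g ≅ so(V̄ ⊕ ℚ², q̄ ⊕ (0 1; 1 0))`", with
  the proof (p. 9), verbatim: "Starting from the decomposition `g = g₋₂ ⊕ (ḡ ⊕ ℚh) ⊕ g₂`, one sees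
  that `ḡ ≅ so(V̄, q̄) ≅ ∧²V̄`, and `g_{±2} ≅ V̄` as `ḡ`-representations (e.g. `g₂` is generated by
  commuting Lefschetz operators `L_x` for `x ∈ H²(X) = V̄`). Identifying `g_{±2}` with `V̄`, and `ḡ`
  with `∧²V̄` by the rule `a ∧ b ↦ ½(q̄(a,-) ⊗ b - q̄(b,-) ⊗ a)` […] we have the following bracket
  rules (which determine `g` starting from `ḡ`): (1) […] `[h,a] = -2a`, `[h,b] = 2b`, `[h,e] = 0`
  for `a ∈ g₋₂`, `b ∈ g₂`, `e ∈ ḡ`; `[a,a'] = 0` for `a, a' ∈ g₋₂`. `[b,b'] = 0` for `b, b' ∈ g₂`.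
  (2) […] `[e,a] = e.a ∈ g₋₂`, `[e,b] = e.b ∈ g₂` […]. (3) Finally, the interesting cross-term
  relation: `[a,b] = a ∧ b + q̄(a,b) h ∈ g₀` for `a ∈ g₋₂`, `b ∈ g₂`. All of these bracket relations
  are defined over `ℚ`." (p. 9, L60 of the arXiv text: the ℚ-definability sentence, which with LL97's
  rational-map remark below licenses the statement over `ℂ`.)  Here `q̄` is the Beauville–Bogomolov
  form, `h` the degree operator.
* M. Verbitsky, *Cohomology of compact hyper-Kähler manifolds and its applications*, GAFA 6 (1996)
  (the Lefschetz property of `L_x` for `q(x) ≠ 0` via the `SO(3)`-action; LL §4).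

## Rendering (tree carriers: `totalCohomology`, `degreeOperator`, `totalLefschetz`, `IsDualLefschetz`,
`llvAlgebra` of `Hyperkaehler/LooijengaLuntsVerbitsky`, with `R = ℂ`, `Y = X(ℂ)`, `N = 2n`)

The fact `LooijengaLuntsVerbitsky_llvStructure_kumType` asserts, for `X` smooth projective of
dimension `2n` of `Kumⁿ`-type (`1 ≤ n`), the EXISTENCE of: a symmetric bilinear form `q` on
`H² = H²(X(ℂ); ℂ)` (the complexified Beauville–Bogomolov form, up to the scalar absorbed below), a
linear map `M : H² → gl(H*)` (the identification `V̄ ≅ g₋₂`, `a ↦ a`), an alternating bilinear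
`N : H² × H² → gl(H*)` (`(a, b) ↦ a ∧ b ∈ ḡ`) and a scalar `κ ≠ 0` (the normalisation `½` of the
rule `a ∧ b ↦ ½(…)`, kept free so that no convention is asserted), such that: all `L_x`, `M x`,
`N x y` lie in `g`; `g ⊆ L(H²) + M(H²) + N(H² × H²) + ℂh` (the decomposition, as a spanning
statement); `[h, M x] = -2 M x`, `[h, N x y] = 0` (rule (1)); `[M x, M y] = 0` (rule (1));
`[M x, L y] = N x y + q(x, y) h` (rule (3)); `[N x y, M z] = κ (q(x, z) M y - q(y, z) M x)` (rule (2)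
for `g₋₂ ≅ V̄` the standard representation of `so(V̄, q̄) ≅ ∧²V̄`); and: a class `ℓ` admitting a dual
Lefschetz operator has `q(ℓ, ℓ) ≠ 0` (Verbitsky/LL §4: the Lefschetz property of `L_ℓ` forces
`q(ℓ) ≠ 0`, e.g. by Fujiki's relation `∫ ℓ^{2n} = c_X q(ℓ)ⁿ`).  Over `ℂ` rather than `ℚ`: LL §1
(rational map remark) — `g(X; ℂ) = g(X; ℚ) ⊗ ℂ`.  Scalars: if the printed `h`-coefficient in (3)
were `c·q̄`, take `q := c·q̄`; the rule-(2) constant is existentially quantified; hence the record is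
convention-free.  A THEOREM in print (status: proved; unproved in the tree).

## Kernel consequences (proved here)

* `finite_totalCohomology` — `H*(X(ℂ); ℂ)` is finite-dimensional for `X` smooth projective (from the
  tree's PROVED `finite_singularCohomology_of_compact_chartedSpace` and
  `subsingleton_singularCohomology_of_lt`), so dual Lefschetz operators are unique
  (`Literature.Algebra.Lie.dualPartner_unique`);
* `dualLefschetz_eq_of_llvStructure` — under the fact, `Λ_ℓ = -q(ℓ,ℓ)⁻¹ M ℓ` for every
  `sl(2)`-triple `(L_ℓ, h, Λ_ℓ)`;
* **`llvAlgebra_le_lieSpan_of_llvStructure`** — under the fact, for every `sl(2)`-triple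
  `(L_ℓ, h, Λ)`: `g ≤ Lie⟨{L_x : x ∈ H²} ∪ {Λ}⟩` (the three-line computation: `M ℓ ∈ A`;
  `[M ℓ, L y] = N ℓ y + q(ℓ,y)h` gives `h, N ℓ y ∈ A`; `[N ℓ y, M ℓ] = κ(q(ℓ,ℓ) M y - q(y,ℓ) M ℓ)`
  gives `M y ∈ A`; then `N x y ∈ A`; the spanning clause concludes).  This is hypothesis `hgen` of
  `Hyperkaehler/LLVGeneration.llvCupSpan_le_opCupSpan` and the statement `LieSpanLefschetzKum4` of the
  H3 chain `Summits/Ventures/HodgeKum4`.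

## Not here

The LLV decompositions themselves (GKLR Cor. 32 for `Kum_n`); the `K3^[n]`/OG cases (same theorem,
not needed); any identification of `q` with the tree's `beauvilleForm` (not needed by the consumers).
-/

noncomputable section

open DirectSum
open Literature.AlgebraicTopology.SingularHomology
open Literature.AlgebraicGeometry.Motives

universe u

namespace Literature.AlgebraicGeometry.Hyperkaehler

-- commutator bracket on `gl(H*)`, Mathlib's local-instance idiom (as in `LooijengaLuntsVerbitsky`)
attribute [local instance 100] LieRing.ofAssociativeRing

/-! ### Finite-dimensionality of `H*(X(ℂ); ℂ)` and uniqueness of dual Lefschetz operators -/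

section Finite

variable {n : ℕ} {X : SchemeOver ℂ}

/-- **`H*(X(ℂ); ℂ) = ⨁ₖ Hᵏ(X(ℂ); ℂ)` is finite-dimensional** for `X` smooth projective of dimension
`n`: each `Hᵏ` is finite-dimensional (`X(ℂ)` is a compact `2n`-manifold) and `Hᵏ = 0` for
`k > 2n`. [cite: Hatcher2002, §3.3 Thm. 3.26 and App. A Cor. A.8–A.9] -/
theorem finite_totalCohomology (hX : IsSmoothProjective n X) :
    Module.Finite ℂ (totalCohomology ℂ (ComplexPoints X)) := by
  letI := hX.chartedSpace
  haveI := ComplexPoints.compactSpace_of_isSmoothProjective hX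
  haveI := ComplexPoints.t2Space_of_isSmoothProjective hX
  have hfin : ∀ k, Module.Finite ℂ (singularCohomology ℂ ℂ (ComplexPoints X) k) := fun k ↦
    finite_singularCohomology_of_compact_chartedSpace ℂ ℂ (d := 2 * n) k
  -- the finite sup of the images of `Hᵏ`, `k ≤ 2n`, is everything
  set S : Submodule ℂ (totalCohomology ℂ (ComplexPoints X)) :=
    (Finset.range (2 * n + 1)).sup fun k ↦ LinearMap.range (ofDegree ℂ (ComplexPoints X) k) with hS
  have hSfg : S.FG := by
    refine Submodule.fg_finset_sup _ _ fun k _ ↦ ?_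
    rw [← Submodule.map_top]
    exact (Module.finite_def.mp (hfin k)).map _
  have htop : (⊤ : Submodule ℂ (totalCohomology ℂ (ComplexPoints X))) = S := by
    refine le_antisymm (fun v _ ↦ ?_) le_top
    induction v using DirectSum.induction_on with
    | zero => exact S.zero_mem
    | of k x =>
      by_cases hk : k ≤ 2 * n
      · have hmem : k ∈ Finset.range (2 * n + 1) := Finset.mem_range.mpr (Nat.lt_succ_of_le hk)
        exact (Finset.le_sup (f := fun k ↦ LinearMap.range (ofDegree ℂ (ComplexPoints X) k)) hmem)
          ⟨x, rfl⟩
      · haveI := ComplexPoints.subsingleton_singularCohomology_of_lt hX ℂ (k := k) (by omega)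
        rw [Subsingleton.elim x 0, map_zero]
        exact S.zero_mem
    | add v w hv hw => exact S.add_mem (hv trivial) (hw trivial)
  exact Module.finite_def.mpr (htop ▸ hSfg)

/-- **Dual Lefschetz operators on `H*(X(ℂ); ℂ)` are unique** (`X` smooth projective): if `(L_a, h, Λ)`
and `(L_a, h, Λ')` are both `sl(2)`-triples then `Λ = Λ'` (Looijenga–Lunts §1: "This `f` is then
unique"). [cite: LooijengaLunts1997, §1 p. 4] -/
theorem IsDualLefschetz.unique (hX : IsSmoothProjective n X) {N : ℕ}
    {a : singularCohomology ℂ ℂ (ComplexPoints X) 2}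
    {Λ Λ' : Module.End ℂ (totalCohomology ℂ (ComplexPoints X))} (h : IsDualLefschetz N a Λ)
    (h' : IsDualLefschetz N a Λ') : Λ = Λ' := by
  haveI := finite_totalCohomology hX
  exact Literature.Algebra.Lie.dualPartner_unique h h'

end Finite

/-! ### The named fact -/

/-- **Looijenga–Lunts 1997 (4.5) / Verbitsky 1996 / Green–Kim–Laza–Robles 2022 Thm. 14 — the LLV
algebra of a compact hyper-Kähler manifold is `so(H² ⊕ ℚ², q̄ ⊕ hyp)`, in operator form, for
projective manifolds of `Kumⁿ`-type.**  For `1 ≤ n` and `X` smooth projective of dimension `2n` of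
`Kumⁿ`-type, with `g = llvAlgebra ℂ X(ℂ) (2n)`, `h = degreeOperator`, `L = totalLefschetz`: there are
a symmetric bilinear `q` on `H²(X(ℂ); ℂ)`, a linear `M : H² → gl(H*)` (`g₋₂ ≅ V̄`), an alternating
bilinear `N : H² × H² → gl(H*)` (`ḡ ≅ ∧²V̄`) and `κ ≠ 0` with: `L x, M x, N x y ∈ g`;
`g ⊆ L(H²) + M(H²) + span N(H², H²) + ℂh`; `[h, M x] = -2 M x`; `[h, N x y] = 0`; `[M x, M y] = 0`;
`[M x, L y] = N x y + q(x,y) h` (GKLR rule (3)); `[N x y, M z] = κ (q(x,z) M y - q(y,z) M x)`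
(rule (2)); and `q(ℓ,ℓ) ≠ 0` whenever `L_ℓ` has a dual Lefschetz operator (Verbitsky; LL §4).
Conventions are absorbed into `q` and `κ` (module docstring).  A THEOREM in print, unproved in the
tree. [cite: LooijengaLunts1997, (4.5) Proposition and (4.7) Example]
[cite: GreenKimLazaRobles2022, Thm. 14 (and its proof, rules (1)–(3))] -/
def LooijengaLuntsVerbitsky_llvStructure_kumType : Prop :=
  ∀ (n : ℕ), 1 ≤ n → ∀ ⦃X : SchemeOver ℂ⦄, IsSmoothProjective (2 * n) X →
    IsOfGeneralizedKummerType n X →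
    ∃ (q : singularCohomology ℂ ℂ (ComplexPoints X) 2 →ₗ[ℂ]
          singularCohomology ℂ ℂ (ComplexPoints X) 2 →ₗ[ℂ] ℂ)
      (M : singularCohomology ℂ ℂ (ComplexPoints X) 2 →ₗ[ℂ]
          Module.End ℂ (totalCohomology ℂ (ComplexPoints X)))
      (N : singularCohomology ℂ ℂ (ComplexPoints X) 2 →ₗ[ℂ]
          singularCohomology ℂ ℂ (ComplexPoints X) 2 →ₗ[ℂ]
            Module.End ℂ (totalCohomology ℂ (ComplexPoints X)))
      (κ : ℂ),
      (∀ x y, q x y = q y x) ∧ (∀ x y, N x y = -N y x) ∧ κ ≠ 0 ∧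
      (∀ x, totalLefschetz x ∈ llvAlgebra ℂ (ComplexPoints X) (2 * n)) ∧
      (∀ x, M x ∈ llvAlgebra ℂ (ComplexPoints X) (2 * n)) ∧
      (∀ x y, N x y ∈ llvAlgebra ℂ (ComplexPoints X) (2 * n)) ∧
      (∀ E ∈ llvAlgebra ℂ (ComplexPoints X) (2 * n),
        ∃ (a b : singularCohomology ℂ ℂ (ComplexPoints X) 2)
          (S : Module.End ℂ (totalCohomology ℂ (ComplexPoints X))) (c : ℂ),
          S ∈ Submodule.span ℂ {E' | ∃ x y, E' = N x y} ∧
            E = totalLefschetz a + M b + S + c • degreeOperator ℂ (ComplexPoints X) (2 * n)) ∧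
      (∀ x, ⁅degreeOperator ℂ (ComplexPoints X) (2 * n), M x⁆ = -((2 : ℂ) • M x)) ∧
      (∀ x y, ⁅degreeOperator ℂ (ComplexPoints X) (2 * n), N x y⁆ = 0) ∧
      (∀ x y, ⁅M x, M y⁆ = 0) ∧
      (∀ x y, ⁅M x, totalLefschetz y⁆ = N x y + q x y • degreeOperator ℂ (ComplexPoints X) (2 * n)) ∧
      (∀ x y z, ⁅N x y, M z⁆ = κ • (q x z • M y - q y z • M x)) ∧
      (∀ (ℓ : singularCohomology ℂ ℂ (ComplexPoints X) 2)
        (Λ : Module.End ℂ (totalCohomology ℂ (ComplexPoints X))),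
        IsDualLefschetz (2 * n) ℓ Λ → q ℓ ℓ ≠ 0)

/-! ### Kernel consequences -/

namespace LooijengaLuntsVerbitsky_llvStructure_kumType

variable {n : ℕ} {X : SchemeOver ℂ}

/-- An alternating `N` vanishes on the diagonal (characteristic `0`). [cite: GreenKimLazaRobles2022, Thm. 14 (proof)] -/
private theorem alt_self_eq_zero
    {N : singularCohomology ℂ ℂ (ComplexPoints X) 2 →ₗ[ℂ] singularCohomology ℂ ℂ (ComplexPoints X) 2 →ₗ[ℂ]
      Module.End ℂ (totalCohomology ℂ (ComplexPoints X))}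
    (hN : ∀ x y, N x y = -N y x) (x : singularCohomology ℂ ℂ (ComplexPoints X) 2) : N x x = 0 := by
  have h2 : (2 : ℂ) • N x x = 0 := by
    rw [two_smul]
    nth_rewrite 2 [hN x x]
    exact add_neg_cancel _
  exact (smul_eq_zero.mp h2).resolve_left two_ne_zero


/-- `⁅A, c • B⁆ = c • ⁅A, B⁆` for the commutator bracket on `gl` (plumbing, instance-robust form). [folklore] -/
private theorem lie_smul_end {V : Type*} [AddCommGroup V] [Module ℂ V] (A B : Module.End ℂ V) (c : ℂ) :
    ⁅A, c • B⁆ = c • ⁅A, B⁆ := by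
  rw [Ring.lie_def, Ring.lie_def, mul_smul_comm, smul_mul_assoc, smul_sub]

/-- **`Λ_ℓ = -q(ℓ,ℓ)⁻¹ · M(ℓ)`**: under the structure fact, the dual Lefschetz operator of a
Lefschetz class `ℓ` is the element of `g₋₂ ≅ V̄` corresponding to `-ℓ/q(ℓ)` (rule (3) with
`a = b = ℓ`, and uniqueness of dual Lefschetz operators). [cite: GreenKimLazaRobles2022, Thm. 14 (proof, rule (3))]
[cite: LooijengaLunts1997, §1 p. 4] -/
theorem dualLefschetz_eq (hF : LooijengaLuntsVerbitsky_llvStructure_kumType) (hn : 1 ≤ n)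
    (hX : IsSmoothProjective (2 * n) X) (hK : IsOfGeneralizedKummerType n X) :
    ∃ (q : singularCohomology ℂ ℂ (ComplexPoints X) 2 →ₗ[ℂ]
          singularCohomology ℂ ℂ (ComplexPoints X) 2 →ₗ[ℂ] ℂ)
      (M : singularCohomology ℂ ℂ (ComplexPoints X) 2 →ₗ[ℂ]
          Module.End ℂ (totalCohomology ℂ (ComplexPoints X))),
      (∀ x, M x ∈ llvAlgebra ℂ (ComplexPoints X) (2 * n)) ∧
      ∀ (ℓ : singularCohomology ℂ ℂ (ComplexPoints X) 2)
        (Λ : Module.End ℂ (totalCohomology ℂ (ComplexPoints X))),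
        IsDualLefschetz (2 * n) ℓ Λ → q ℓ ℓ ≠ 0 ∧ Λ = -((q ℓ ℓ)⁻¹ • M ℓ) := by
  obtain ⟨q, M, N, κ, -, hNa, -, -, hMg, -, -, hhM, -, -, hML, -, hLef⟩ := hF n hn hX hK
  refine ⟨q, M, hMg, fun ℓ Λ hΛ ↦ ?_⟩
  have hq : q ℓ ℓ ≠ 0 := hLef ℓ Λ hΛ
  refine ⟨hq, IsDualLefschetz.unique hX hΛ ?_⟩
  rw [isDualLefschetz_iff]
  refine ⟨hΛ.h_ne_zero, ?_, ?_⟩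
  · rw [lie_neg, lie_smul_end, ← lie_skew, hML, alt_self_eq_zero hNa, zero_add, smul_neg, neg_neg,
      smul_smul, inv_mul_cancel₀ hq, one_smul]
  · rw [lie_neg, lie_smul_end, hhM]
    simp only [two_smul, smul_neg, smul_add, neg_add, neg_neg]

/-- **Lie generation: `g ≤ Lie⟨{L_x : x ∈ H²} ∪ {Λ}⟩` for every `sl(2)`-triple `(L_ℓ, h, Λ)`** on
`H*(X(ℂ); ℂ)`, `X` smooth projective of `Kumⁿ`-type (`1 ≤ n`), GIVEN the structure fact.  The
elementary computation on GKLR's rules: `M ℓ = -q(ℓ,ℓ) Λ ∈ A`; `[M ℓ, L y] = N ℓ y + q(ℓ,y) h` puts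
`h` (take `y = ℓ`) and all `N ℓ y` in `A`; `[N ℓ y, M ℓ] = κ(q(ℓ,ℓ) M y - q(y,ℓ) M ℓ)` puts all `M y`
in `A`; `[M x, L y]` puts all `N x y` in `A`; the spanning clause concludes.
[cite: GreenKimLazaRobles2022, Thm. 14 (proof, rules (1)–(3))] [cite: LooijengaLunts1997, (4.5) Proposition] -/
theorem llvAlgebra_le_lieSpan (hF : LooijengaLuntsVerbitsky_llvStructure_kumType) (hn : 1 ≤ n)
    (hX : IsSmoothProjective (2 * n) X) (hK : IsOfGeneralizedKummerType n X)
    (ℓ : singularCohomology ℂ ℂ (ComplexPoints X) 2)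
    (Λ : Module.End ℂ (totalCohomology ℂ (ComplexPoints X))) (hΛ : IsDualLefschetz (2 * n) ℓ Λ) :
    llvAlgebra ℂ (ComplexPoints X) (2 * n) ≤
      LieSubalgebra.lieSpan ℂ (Module.End ℂ (totalCohomology ℂ (ComplexPoints X)))
        ({E | ∃ a : singularCohomology ℂ ℂ (ComplexPoints X) 2, E = totalLefschetz a} ∪ {Λ}) := by
  obtain ⟨q, M, N, κ, hqs, hNa, hκ, -, hMg, -, hspan, hhM, -, -, hML, hNM, hLef⟩ := hF n hn hX hK
  set A := LieSubalgebra.lieSpan ℂ (Module.End ℂ (totalCohomology ℂ (ComplexPoints X)))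
    ({E | ∃ a : singularCohomology ℂ ℂ (ComplexPoints X) 2, E = totalLefschetz a} ∪ {Λ}) with hA
  set h := degreeOperator ℂ (ComplexPoints X) (2 * n) with hh_def
  have hΛA : Λ ∈ A := LieSubalgebra.subset_lieSpan (Or.inr rfl)
  have hLA : ∀ y, totalLefschetz y ∈ A := fun y ↦ LieSubalgebra.subset_lieSpan (Or.inl ⟨y, rfl⟩)
  have hq : q ℓ ℓ ≠ 0 := hLef ℓ Λ hΛ
  -- `Λ = -q(ℓ,ℓ)⁻¹ M ℓ` by uniqueness, hence `M ℓ ∈ A`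
  have hΛ' : IsDualLefschetz (2 * n) ℓ (-((q ℓ ℓ)⁻¹ • M ℓ)) := by
    rw [isDualLefschetz_iff]
    refine ⟨hΛ.h_ne_zero, ?_, ?_⟩
    · rw [lie_neg, lie_smul_end, ← lie_skew, hML, alt_self_eq_zero hNa, zero_add, smul_neg, neg_neg,
        smul_smul, inv_mul_cancel₀ hq, one_smul]
    · rw [lie_neg, lie_smul_end, hhM]
      simp only [two_smul, smul_neg, smul_add, neg_add, neg_neg]
  have hΛeq : Λ = -((q ℓ ℓ)⁻¹ • M ℓ) := IsDualLefschetz.unique hX hΛ hΛ'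
  have hMℓ : M ℓ ∈ A := by
    have : M ℓ = -(q ℓ ℓ • Λ) := by
      rw [hΛeq, smul_neg, smul_smul, mul_inv_cancel₀ hq, one_smul, neg_neg]
    rw [this]
    exact A.neg_mem (A.smul_mem _ hΛA)
  -- `h ∈ A`
  have hhA : h ∈ A := by
    rw [hh_def, ← hΛ.lie_e_f]
    exact A.lie_mem (hLA ℓ) hΛA
  -- `N ℓ y ∈ A`
  have hN1 : ∀ y, N ℓ y ∈ A := fun y ↦ by
    have h1 : ⁅M ℓ, totalLefschetz y⁆ ∈ A := A.lie_mem hMℓ (hLA y)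
    rw [hML] at h1
    simpa only [add_sub_cancel_right] using A.sub_mem h1 (A.smul_mem (q ℓ y) hhA)
  -- `M y ∈ A`
  have hM : ∀ y, M y ∈ A := fun y ↦ by
    have h1 : ⁅N ℓ y, M ℓ⁆ ∈ A := A.lie_mem (hN1 y) hMℓ
    rw [hNM] at h1
    -- `κ • (q ℓ ℓ • M y - q y ℓ • M ℓ) ∈ A` ⇒ `M y ∈ A`
    have h2 : κ • (q ℓ ℓ • M y) ∈ A := by
      have := A.add_mem h1 (A.smul_mem κ (A.smul_mem (q y ℓ) hMℓ))
      simpa only [smul_sub, sub_add_cancel] using this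
    have h3 : (κ * q ℓ ℓ)⁻¹ • (κ • (q ℓ ℓ • M y)) = M y := by
      rw [smul_smul, smul_smul, mul_assoc, inv_mul_cancel₀ (mul_ne_zero hκ hq), one_smul]
    rw [← h3]
    exact A.smul_mem _ h2
  -- `N x y ∈ A`
  have hN : ∀ x y, N x y ∈ A := fun x y ↦ by
    have h1 : ⁅M x, totalLefschetz y⁆ ∈ A := A.lie_mem (hM x) (hLA y)
    rw [hML] at h1
    simpa only [add_sub_cancel_right] using A.sub_mem h1 (A.smul_mem (q x y) hhA)
  -- conclude by the spanning clause
  intro E hE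
  obtain ⟨a, b, S, c, hS, rfl⟩ := hspan E hE
  refine A.add_mem (A.add_mem (A.add_mem (hLA a) (hM b)) ?_) (A.smul_mem c hhA)
  refine (Submodule.span_le (p := A.toSubmodule)).mpr ?_ hS
  rintro _ ⟨x, y, rfl⟩
  exact hN x y

end LooijengaLuntsVerbitsky_llvStructure_kumType

end Literature.AlgebraicGeometry.Hyperkaehler

end
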